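import Summits.QuantumFields.BalabanUV.Beta.GAN24.ScaledPartMM
import Summits.QuantumFields.BalabanUV.Beta.GAN24.ScaledPartFF
import Summits.QuantumFields.BalabanUV.Beta.GAN24.ScaledPartMF

/-!
# `BalabanUV.Beta.GAN24.FibreUniformBound` — binder row G-an2-4 / (CONV-C), road P1-fibre, leaf **P1-L09** of gan24-p1's `SKELETON-P1` leaf table
# (A5, REAL ZONE), FINAL ASSEMBLY: the N-UNIFORM bound of the wall's fibre function `kFib` at the literal units on the whole Brillouin zone, `d = 3`

NOT IN PRINT; OUR PROOF ATTEMPT.  HONEST FRAMING (cell contract, verbatim): «discharging `BetaPertH` makes Bałaban's UV stability UNCONDITIONAL — a real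
constructive-QFT result; it is NOT the continuum limit and NOT the Clay problem.»  HONEST DEPENDENCY (verbatim): «continuum YM on T⁴ ⇐ BetaPertH ∧ nine spine
estimates (0/9 proved); BetaPertH ⇐ (D1) ∧ (D4) ∧ CAP+tail; G-an2-4 gates asym, D1 and NE2/3/4.»  [folklore] one-line assembly of the swarm's landed parts BY NAME
(no new estimate, no cited fact, no wall binder, no `def … : Prop` fact).  NOT summit progress: this is (I3′)'s REAL-ZONE half only — no strip, no decay, no rate;
nothing of (CONV-C)'s K-slot `GAN24.CombesThomas.ConvCK 3 Lc` is discharged by it (rows L10/L11/L12 are downstream); NOT BetaPertH, NOT continuum, NOT Clay.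

## What is proved (`d = 3`, i.e. `D = d + 1 = 4`; every blocking factor `Lc ≥ 1`)
**`fibreUniformBound`** — row P1-L09 «∀ j, ∀ p ∈ BZ, ∀ legs, ‖kFib Lc sfStep (smStep 3) j a x′ b y′ (ofRealVec p)‖ ≤ C(D=4, Lc)»:
  `∀ j x′ y′ a b, ∀ q ∈ BZ 4, ‖kFib Lc (sfStep Lc) (smStep 3 Lc) j a x′ b y′ (ofRealVec q)‖ ≤ l09Const Lc`,
  `l09Const Lc = xFF 4 Lc / Lc² + fmConst 4 + bPhi0 4 Lc (4π²) / Lc⁵ + cPP 4 · 4π²` (explicit; N- and j-free);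
and the existential form `fibreUniformBound_exists`.  Assembly = `FibreUniformBoundOfParts.fibreUniformBound_step_of_scaled` (leaf-05: bridge `kFib = kFibClosed`
p202431 + leaf-03's plug + leaf-08's continuity) on the four N-uniform scaled parts H1 `ScaledPartFF.scaledFF_three_of_mem_BZ` (leaf-03-g6), H2
`ScaledPartFM.scaledFM_three` (leaf-17-g4), H3 `ScaledPartMF.scaledMF_step` (leaf-18-g6), H4 `FibreUniformBound.scaledMM_step` (leaf-05-g6), themselves built on
T00 `AliasObjects` (leaf-14), Y09a `FieldBlockResponse` (leaf-10), Y09b/Y09x `ReadingWeightSums`/`ReadingWeightCrossSums` (leaf-01/leaf-03), L08 `CapacitanceEndpoint`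
(leaf-20) over leaf-02/leaf-12's capacitance closed form and scalar bounds, L05 `Capacitance(Solve)` (leaf-06/leaf-15), L04 `FibreDFT`/`FibreArrow` (leaf-16/leaf-06),
L06/L07 (leaf-17/leaf-10), E2 (leaf-13/leaf-11) — `SKELETON-P1.md` A4/A5 (real zone) of gan24-p1.
Unit `b2b-balaban-gan24-formalise-leaf-05` (G-an2-4 formalisation swarm), 2026-08-20.
-/

noncomputable section

open scoped Real
open Literature.MathematicalPhysics.QuantumFieldTheory
open Literature.MathematicalPhysics.QuantumFieldTheory.Balaban1983to89
open Literature.MathematicalPhysics.QuantumFieldTheory.Balaban1983to89.Beta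
open B4Strip (ofRealVec)
open B4ContourShift (BZ)
open OneStepResolventKernel (Fib)
open Summit.QuantumFields.BalabanUV.Beta.GAN24.CombesThomas (sfStep smStep)
open Summit.QuantumFields.BalabanUV.Beta.GAN24.CombesThomasFibreStep (kFib)
open Summit.QuantumFields.BalabanUV.Beta.GAN24.CapacitanceEndpointBlocks (cPP)
open Summit.QuantumFields.BalabanUV.Beta.GAN24.ForceSourceFeedback (bPhi0)
open Summit.QuantumFields.BalabanUV.Beta.GAN24.ScaledPartFF (xFF scaledFF_three_of_mem_BZ)
open Summit.QuantumFields.BalabanUV.Beta.GAN24.ScaledPartFM (fmConst scaledFM_three)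
open Summit.QuantumFields.BalabanUV.Beta.GAN24.ScaledPartMF (scaledMF_step)

namespace Summit.QuantumFields.BalabanUV.Beta.GAN24.FibreUniformBound

/-- [folklore] THE L09 CONSTANT `C(D = 4, Lc) = K₁ + K₂ + K₃ + K₄` of the four scaled parts (explicit, `N`- and `j`-free). -/
def l09Const (Lc : ℕ) : ℝ :=
  xFF 4 Lc / (Lc : ℝ) ^ 2 + fmConst 4 + bPhi0 4 (Lc : ℝ) (4 * π ^ 2) / (Lc : ℝ) ^ 5 + cPP 4 * (4 * π ^ 2)

/-- [folklore] **ROW P1-L09 — THE N-UNIFORM REAL-ZONE BOUND OF THE WALL's FIBRE FUNCTION (A5, real zone; `d = 3`).**  For every blocking factor `Lc ≥ 1`,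
every step `j`, all leg data `x′ y′ a b` and every `q ∈ BZ 4`:
`‖kFib Lc (sfStep Lc) (smStep 3 Lc) j a x′ b y′ (ofRealVec q)‖ ≤ l09Const Lc`. -/
theorem fibreUniformBound (Lc : ℕ) [NeZero Lc] :
    ∀ (j : ℕ) (x' y' : Fin (3 + 1) → ℤ) (a b : Fib 3), ∀ q ∈ BZ (3 + 1),
      ‖kFib Lc (sfStep Lc) (smStep 3 Lc) j a x' b y' (ofRealVec q)‖ ≤ l09Const Lc :=
  fibreUniformBound_step_of_scaled (d := 3) (Lc := Lc)
    (fun j _ hq hq0 κ l x' y' => scaledFF_three_of_mem_BZ Lc j hq hq0 κ l x' y')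
    (fun j _ hq hq0 κ l x' => scaledFM_three Lc j hq hq0 κ l x')
    (scaledMF_step Lc)
    (scaledMM_step Lc)

/-- [folklore] Existential form of row P1-L09: `∃ C, ∀ j x′ y′ a b, ∀ q ∈ BZ 4, ‖kFib Lc (sfStep Lc) (smStep 3 Lc) j a x′ b y′ (ofRealVec q)‖ ≤ C`. -/
theorem fibreUniformBound_exists (Lc : ℕ) [NeZero Lc] :
    ∃ C : ℝ, ∀ (j : ℕ) (x' y' : Fin (3 + 1) → ℤ) (a b : Fib 3), ∀ q ∈ BZ (3 + 1),
      ‖kFib Lc (sfStep Lc) (smStep 3 Lc) j a x' b y' (ofRealVec q)‖ ≤ C :=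
  ⟨l09Const Lc, fibreUniformBound Lc⟩

end Summit.QuantumFields.BalabanUV.Beta.GAN24.FibreUniformBound

end
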